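import Summits.CriticalPhenomena.PercolationContinuityZ3.Theorems.SahiMasterFamilyFInequalityMSTightSplit
import Summits.CriticalPhenomena.PercolationContinuityZ3.Theorems.SahiMasterFamilyFInequalityMSTightPivot

/-!
# Equality in Marica–Schönheim, III: every coordinate of a tight family is decreasing or increasing (in blocks)

Support file for the master-family `F`-inequality programme (`prim-master-conj` gen 29; `--supports stmt-CriticalPhenomena-4575`;
memo `run/shared/lean/prim/prim-l12/prim-master-conj/MS-EQUALITY.md` §1.3 Steps 1–2').  No definition, no `sorry`, standard axioms.

For a tight family `F` (`#(F \\ F) = #F`) and a coordinate `r` lying in some but not all members, exactly the smaller of the two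
sections `P = F.memberSubfamily r`, `Q = F.nonMemberSubfamily r` governs:

* `exists_decreasing_block` — if `#P ≤ #Q` and the (then tight) family `Q` has a pivot, there is a block `β ∋ r` such that every
  member of `F` either contains `β` and stays in `F` when `β` is removed, or is disjoint from `β` ("`r` is DECREASING");
* `exists_increasing_block` — if `#Q ≤ #P` and the complemented family `{K \ p : p ∈ P}` (`K = (⋃ F).erase r`, then tight) has
  a pivot, there is a block `β ∋ r` such that every member either is disjoint from `β` and stays in `F` when `β` is added, or
  contains `β` ("`r` is INCREASING").
The first is Step 1 (`tight_section_of_card_le`) + LEMMA α (`exists_core_of_sections`); the second is the first applied to the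
complemented sections (`diffs_image_sdiff_eq`, `card_image_sdiff_eq`: complementation inside a common superset preserves
difference families, reversing the roles of `P` and `Q`), via the dual Step 1 `tight_section_of_card_ge`.
The pivots are supplied by induction in part IV.

HONEST FRAMING: steps of a proof of the equality case of Marica–Schönheim that we could not find in print; [this work].
-/

namespace Summit.CriticalPhenomena.PercolationContinuityZ3.Theorems

namespace TwistedAD

open Finset
open scoped FinsetFamily

variable {α : Type*} [DecidableEq α]

/-! ### Step 1, dual form -/

/-- **Step 1 (dual).**  If `F` is tight, `Q = F.nonMemberSubfamily r` is nonempty and `#Q ≤ #P` (`P = F.memberSubfamily r`), then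
`P` is tight, `Q \\ Q ⊆ P \\ P`, `Q \\ P ⊆ P \\ P`, and `#(P \\ Q) = #Q`. [this work] -/
theorem tight_section_of_card_ge (F : Finset (Finset α)) (r : α) (htight : #(F \\ F) = #F)
    (hQ : (F.nonMemberSubfamily r).Nonempty) (hQP : #(F.nonMemberSubfamily r) ≤ #(F.memberSubfamily r)) :
    #((F.memberSubfamily r) \\ (F.memberSubfamily r)) = #(F.memberSubfamily r) ∧
    (F.nonMemberSubfamily r) \\ (F.nonMemberSubfamily r) ⊆ (F.memberSubfamily r) \\ (F.memberSubfamily r) ∧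
    (F.nonMemberSubfamily r) \\ (F.memberSubfamily r) ⊆ (F.memberSubfamily r) \\ (F.memberSubfamily r) ∧
    #((F.memberSubfamily r) \\ (F.nonMemberSubfamily r)) = #(F.nonMemberSubfamily r) := by
  set P := F.memberSubfamily r with hPdef
  set Q := F.nonMemberSubfamily r with hQdef
  set R := (Q \\ Q) ∪ (Q \\ P) ∪ (P \\ P) with hRdef
  have hsplit : #(F \\ F) = #(P \\ Q) + #R := card_diffs_eq_card_add_card F r
  have hPQF : #P + #Q = #F := card_memberSubfamily_add_card_nonMemberSubfamily r F
  have hsum : #(P \\ Q) + #R = #Q + #P := by rw [← hsplit, htight, ← hPQF, add_comm]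
  have hQQ : #Q ≤ #(Q \\ Q) := Q.card_le_card_diffs
  have hPP : #P ≤ #(P \\ P) := P.card_le_card_diffs
  have hRQQ : #(Q \\ Q) ≤ #R := card_le_card (fun x hx => by
    rw [hRdef, mem_union, mem_union]; exact Or.inl (Or.inl hx))
  have hRQP : #(Q \\ P) ≤ #R := card_le_card (fun x hx => by
    rw [hRdef, mem_union, mem_union]; exact Or.inl (Or.inr hx))
  have hRPP : #(P \\ P) ≤ #R := card_le_card (fun x hx => by
    rw [hRdef, mem_union, mem_union]; exact Or.inr hx)
  have hday : #Q * #P ≤ #(P \\ Q) * #(Q \\ P) := by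
    rw [mul_comm]; exact P.le_card_diffs_mul_card_diffs Q
  have hb : 1 ≤ #Q := card_pos.2 hQ
  obtain ⟨hs, hT, _ht⟩ := step1_arith hsum (hQQ.trans hRQQ) (hPP.trans hRPP) hRQP hday hb hQP
  have hPPR : P \\ P = R := eq_of_subset_of_card_le (fun x hx => by
    rw [hRdef, mem_union, mem_union]; exact Or.inr hx) (by omega)
  refine ⟨by omega, ?_, ?_, hs⟩
  · intro x hx
    rw [hPPR, hRdef, mem_union, mem_union]
    exact Or.inl (Or.inl hx)
  · intro x hx
    rw [hPPR, hRdef, mem_union, mem_union]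
    exact Or.inl (Or.inr hx)

/-! ### Decreasing coordinates -/

/-- **Decreasing block.**  Let `F` be tight and `r` a coordinate with `P = F.memberSubfamily r` nonempty and `#P ≤ #Q`
(`Q = F.nonMemberSubfamily r`).  If `Q` has a pivot then there is a finite set `β ∋ r` such that every `f ∈ F` either contains `β`
with `f \ β ∈ F`, or is disjoint from `β`. [this work] -/
theorem exists_decreasing_block (F : Finset (Finset α)) (htight : #(F \\ F) = #F) (r : α)
    (hP : (F.memberSubfamily r).Nonempty) (hPQ : #(F.memberSubfamily r) ≤ #(F.nonMemberSubfamily r))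
    (hpivQ : ∃ h ∈ F.nonMemberSubfamily r, ∀ q ∈ F.nonMemberSubfamily r,
      h ∪ q ∈ F.nonMemberSubfamily r ∧ h ∩ q ∈ F.nonMemberSubfamily r) :
    ∃ β : Finset α, r ∈ β ∧ ∀ f ∈ F, (β ⊆ f ∧ f \ β ∈ F) ∨ Disjoint β f := by
  set P := F.memberSubfamily r with hPdef
  set Q := F.nonMemberSubfamily r with hQdef
  obtain ⟨hQt, hPP, hQP, hcard⟩ := tight_section_of_card_le F r htight hP hPQ
  obtain ⟨h, hhQ, hpiv⟩ := hpivQ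
  obtain ⟨c, hcQ, hcP⟩ := exists_core_of_sections P Q hQt h hhQ hpiv hP hPP hQP hcard
  refine ⟨insert r c, mem_insert_self r c, fun f hf => ?_⟩
  by_cases hrf : r ∈ f
  · -- `f.erase r ∈ P`
    left
    have hp : f.erase r ∈ P := by
      rw [hPdef, mem_memberSubfamily, insert_erase hrf]; exact ⟨hf, notMem_erase r f⟩
    obtain ⟨hcf, hfc⟩ := hcP _ hp
    refine ⟨?_, ?_⟩
    · intro x hx
      rcases mem_insert.1 hx with rfl | hxc
      · exact hrf
      · exact mem_of_mem_erase (hcf hxc)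
    · have : f \ insert r c = f.erase r \ c := by
        ext x
        simp only [mem_sdiff, mem_insert, mem_erase, not_or]
        tauto
      rw [this]
      exact (mem_nonMemberSubfamily.1 hfc).1
  · -- `f ∈ Q`, disjoint from `c` and from `r`
    right
    have hq : f ∈ Q := by rw [hQdef, mem_nonMemberSubfamily]; exact ⟨hf, hrf⟩
    rw [disjoint_insert_left]
    exact ⟨hrf, hcQ f hq⟩

/-! ### Complementation inside a common superset -/

/-- Complementation inside a superset `K` of all members is injective, so it preserves cardinality. [this work] -/
theorem card_image_sdiff_eq (K : Finset α) (G : Finset (Finset α)) (hG : ∀ g ∈ G, g ⊆ K) :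
    #(G.image fun g => K \ g) = #G := by
  apply card_image_of_injOn
  intro g hg g' hg' hgg
  have : K \ (K \ g) = K \ (K \ g') := by rw [show K \ g = K \ g' from hgg]
  rwa [Finset.sdiff_sdiff_eq_self (hG g hg), Finset.sdiff_sdiff_eq_self (hG g' hg')] at this

/-- Complementation inside a superset of the members of `G'` reverses difference families: `{K \ g} \\ {K \ g'} = G' \\ G`.
[this work] -/
theorem diffs_image_sdiff_eq (K : Finset α) (G G' : Finset (Finset α)) (hG' : ∀ g ∈ G', g ⊆ K) :
    (G.image fun g => K \ g) \\ (G'.image fun g => K \ g) = G' \\ G := by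
  ext e
  simp only [mem_diffs, mem_image]
  constructor
  · rintro ⟨a, ⟨g, hg, rfl⟩, b, ⟨g', hg', rfl⟩, rfl⟩
    refine ⟨g', hg', g, hg, ?_⟩
    ext x
    simp only [mem_sdiff]
    constructor
    · rintro ⟨hxg', hxg⟩
      exact ⟨⟨hG' g' hg' hxg', hxg⟩, fun hx => hx.2 hxg'⟩
    · rintro ⟨⟨hxK, hxg⟩, hx⟩
      refine ⟨?_, hxg⟩
      by_contra hxg'
      exact hx ⟨hxK, hxg'⟩
  · rintro ⟨g', hg', g, hg, rfl⟩
    refine ⟨K \ g, ⟨g, hg, rfl⟩, K \ g', ⟨g', hg', rfl⟩, ?_⟩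
    ext x
    simp only [mem_sdiff]
    constructor
    · rintro ⟨⟨hxK, hxg⟩, hx⟩
      refine ⟨?_, hxg⟩
      by_contra hxg'
      exact hx ⟨hxK, hxg'⟩
    · rintro ⟨hxg', hxg⟩
      exact ⟨⟨hG' g' hg' hxg', hxg⟩, fun hx => hx.2 hxg'⟩

/-! ### Increasing coordinates -/

/-- **Increasing block.**  Let `F` be tight and `r` a coordinate with `Q = F.nonMemberSubfamily r` nonempty and `#Q ≤ #P`
(`P = F.memberSubfamily r`).  Put `K = (F.biUnion id).erase r` (a common superset of the members of `P` and `Q`).  If the complemented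
family `P.image (K \ ·)` has a pivot, then there is a finite set `β ∋ r` such that every `f ∈ F` either is disjoint from `β` with
`f ∪ β ∈ F`, or contains `β`.  (Lemma α for the complemented, role-reversed sections.) [this work] -/
theorem exists_increasing_block (F : Finset (Finset α)) (htight : #(F \\ F) = #F) (r : α)
    (hQ : (F.nonMemberSubfamily r).Nonempty) (hQP : #(F.nonMemberSubfamily r) ≤ #(F.memberSubfamily r))
    (hpiv' : ∃ h ∈ (F.memberSubfamily r).image (fun g => ((F.biUnion id).erase r) \ g),
      ∀ q ∈ (F.memberSubfamily r).image (fun g => ((F.biUnion id).erase r) \ g),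
        h ∪ q ∈ (F.memberSubfamily r).image (fun g => ((F.biUnion id).erase r) \ g) ∧
        h ∩ q ∈ (F.memberSubfamily r).image (fun g => ((F.biUnion id).erase r) \ g)) :
    ∃ β : Finset α, r ∈ β ∧ ∀ f ∈ F, (Disjoint β f ∧ f ∪ β ∈ F) ∨ β ⊆ f := by
  set P := F.memberSubfamily r with hPdef
  set Q := F.nonMemberSubfamily r with hQdef
  set K := (F.biUnion id).erase r with hKdef
  have hPK : ∀ p ∈ P, p ⊆ K := by
    intro p hp x hx
    rw [hPdef, mem_memberSubfamily] at hp
    rw [hKdef, mem_erase]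
    refine ⟨fun hxr => hp.2 (hxr ▸ hx), ?_⟩
    rw [mem_biUnion]
    exact ⟨insert r p, hp.1, mem_insert_of_mem hx⟩
  have hQK : ∀ q ∈ Q, q ⊆ K := by
    intro q hq x hx
    rw [hQdef, mem_nonMemberSubfamily] at hq
    rw [hKdef, mem_erase]
    refine ⟨fun hxr => hq.2 (hxr ▸ hx), ?_⟩
    rw [mem_biUnion]
    exact ⟨q, hq.1, hx⟩
  obtain ⟨hPt, hQQ, hQP', hcard⟩ := tight_section_of_card_ge F r htight hQ hQP
  -- the role-reversed complemented sections
  set P' := Q.image (fun g => K \ g) with hP'def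
  set Q' := P.image (fun g => K \ g) with hQ'def
  have hQ't : #(Q' \\ Q') = #Q' := by
    rw [hQ'def, diffs_image_sdiff_eq K P P hPK, card_image_sdiff_eq K P hPK, hPt]
  have hP'ne : P'.Nonempty := by rw [hP'def]; exact hQ.image _
  have hP'P' : P' \\ P' ⊆ Q' \\ Q' := by
    rw [hP'def, hQ'def, diffs_image_sdiff_eq K Q Q hQK, diffs_image_sdiff_eq K P P hPK]; exact hQQ
  have hQ'P' : Q' \\ P' ⊆ Q' \\ Q' := by
    rw [hP'def, hQ'def, diffs_image_sdiff_eq K P Q hQK, diffs_image_sdiff_eq K P P hPK]; exact hQP'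
  have hcard' : #(P' \\ Q') = #P' := by
    rw [hP'def, hQ'def, diffs_image_sdiff_eq K Q P hPK, card_image_sdiff_eq K Q hQK]; exact hcard
  obtain ⟨h, hhQ', hpiv⟩ := hpiv'
  obtain ⟨c, hcQ', hcP'⟩ := exists_core_of_sections P' Q' hQ't h hhQ' hpiv hP'ne hP'P' hQ'P' hcard'
  -- translate back: `c ⊆ K`, `c ∩ q = ∅` and `q ∪ c ∈ P` for `q ∈ Q`; `c ⊆ p` for `p ∈ P`
  obtain ⟨q₀, hq₀⟩ := hQ
  have hcK : c ⊆ K := (hcP' (K \ q₀) (mem_image_of_mem _ hq₀)).1.trans sdiff_subset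
  have hcq : ∀ q ∈ Q, Disjoint c q ∧ q ∪ c ∈ P := by
    intro q hq
    obtain ⟨hcsub, hmem⟩ := hcP' (K \ q) (mem_image_of_mem _ hq)
    have hdisj : Disjoint c q := by
      rw [disjoint_left]
      intro x hxc hxq
      exact (mem_sdiff.1 (hcsub hxc)).2 hxq
    refine ⟨hdisj, ?_⟩
    rw [hQ'def, mem_image] at hmem
    obtain ⟨p, hp, hpeq⟩ := hmem
    -- `K \ p = (K \ q) \ c = K \ (q ∪ c)` with both `p, q ∪ c ⊆ K`
    have : q ∪ c = p := by
      have h1 : K \ (K \ p) = K \ ((K \ q) \ c) := by rw [hpeq]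
      rw [Finset.sdiff_sdiff_eq_self (hPK p hp), sdiff_sdiff_left, sup_eq_union,
        Finset.sdiff_sdiff_eq_self (union_subset (hQK q hq) hcK)] at h1
      exact h1.symm
    rw [this]
    exact hp
  have hcp : ∀ p ∈ P, c ⊆ p := by
    intro p hp x hxc
    have hd := hcQ' (K \ p) (mem_image_of_mem _ hp)
    by_contra hxp
    exact disjoint_left.1 hd hxc (mem_sdiff.2 ⟨hcK hxc, hxp⟩)
  refine ⟨insert r c, mem_insert_self r c, fun f hf => ?_⟩
  by_cases hrf : r ∈ f
  · -- `f.erase r ∈ P` contains `c`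
    right
    have hp : f.erase r ∈ P := by
      rw [hPdef, mem_memberSubfamily, insert_erase hrf]; exact ⟨hf, notMem_erase r f⟩
    intro x hx
    rcases mem_insert.1 hx with rfl | hxc
    · exact hrf
    · exact mem_of_mem_erase (hcp _ hp hxc)
  · -- `f ∈ Q`: disjoint from `insert r c` and `f ∪ insert r c = insert r (f ∪ c) ∈ F`
    left
    have hq : f ∈ Q := by rw [hQdef, mem_nonMemberSubfamily]; exact ⟨hf, hrf⟩
    obtain ⟨hdisj, hmem⟩ := hcq f hq
    refine ⟨?_, ?_⟩
    · rw [disjoint_insert_left]; exact ⟨hrf, hdisj⟩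
    · rw [hPdef, mem_memberSubfamily] at hmem
      have : f ∪ insert r c = insert r (f ∪ c) := by rw [union_insert]
      rw [this]
      exact hmem.1

end TwistedAD

end Summit.CriticalPhenomena.PercolationContinuityZ3.Theorems
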